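import Literature.Barriers.Parity.SmallScalePatternsSingleForm
import Literature.Barriers.Parity.MaierMatrix
import HarnessLib

/-!
# Small-scale irregularity of linear patterns of primes: the walk along a Bézout direction

Proof companion (part 2 of 3) of `Literature/Barriers/Parity/SmallScalePatterns.lean`
(Pandey–Woo 2024, Theorem 5; the case `t = 1`). Everything here is PROVED.

The device that transfers Maier's irregular WINDOW `(m, m + h]` of integers (a row of Maier's
matrix, `Literature.Barriers.Parity.Maier.matrix_rows`) to an irregular BOX for a single linear
form `ψ(n) = ∑ⱼ cⱼ nⱼ` (`cⱼ ≥ 0`, primitive): pick `v ∈ ℤ^d` with `ψ(v) = 1` (Bézout) and write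
`m + 1 = c₀ q + r`, `c₀ = ∑ⱼ cⱼ = ψ(𝟙)`, `0 ≤ r < c₀`; the corners `z_k = q𝟙 + (r + k) v`,
`0 ≤ k < h`, have `ψ(z_k) = m + 1 + k`, so for `u ∈ {0, …, H}^d` the values `ψ(z_k + u) =
m + 1 + k + ψ(u)` run, as `k` varies, through the window `(m + ψ(u), m + ψ(u) + h]`, a shift by
`ψ(u) ≤ c₀ H` of Maier's window. Double counting (`sum_boxes_eq_sum_windows`) and the trivial
bound "shifting a window by `s` changes its prime count by at most `s`" (`window_shift_le`,
`le_window_shift`) give `∑_k #{u : ψ(z_k + u) prime} = (H+1)^d (π(m+h) − π(m)) + O((H+1)^d c₀ H)`,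
and the pigeonhole principle over `k` produces a box with at least / at most the average
(`exists_box_ge`, `exists_box_le`); all corners lie within `(c₀ + h) ∑ⱼ|vⱼ|` of `q𝟙`. This is the
last step ("applying the pigeonhole within the box") of Pandey–Woo §2.4, run directly on Maier's
rows, which is possible for ONE form. [cite: PandeyWoo2024, §2.4]
-/

noncomputable section

open Filter Finset

namespace Literature.Barriers.Parity

open Literature.NumberTheory.Sieve Literature.Barriers.Parity.Maier

namespace SingleForm

variable {d : ℕ}

/-! ## Windows of integers -/

/-- Shifting the window `(y, y + h]` up by `s = y' − y` loses at most `s` primes: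
`π(y'+h) − π(y') ≤ π(y+h) − π(y) + (y' − y)`. [folklore] -/
theorem window_shift_le (h : ℕ) {y y' : ℕ} (hy : y ≤ y') :
    #{i ∈ range h | (y' + (i + 1)).Prime} ≤ #{i ∈ range h | (y + (i + 1)).Prime} + (y' - y) := by
  obtain ⟨s, rfl⟩ := Nat.exists_eq_add_of_le hy
  have e1 := primeCounting_add_eq y h
  have e2 := primeCounting_add_eq (y + s) h
  have e3 := primeCounting_add_eq (y + h) s
  have e4 := primeCounting_add_eq y s
  have b3 : #{k ∈ range s | (y + h + (k + 1)).Prime} ≤ s :=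
    (card_filter_le _ _).trans (card_range s).le
  rw [show y + s + h = y + h + s by ring] at e2
  omega

/-- … and gains at most `s` primes: `π(y+h) − π(y) ≤ π(y'+h) − π(y') + (y' − y)`. [folklore] -/
theorem le_window_shift (h : ℕ) {y y' : ℕ} (hy : y ≤ y') :
    #{i ∈ range h | (y + (i + 1)).Prime} ≤ #{i ∈ range h | (y' + (i + 1)).Prime} + (y' - y) := by
  obtain ⟨s, rfl⟩ := Nat.exists_eq_add_of_le hy
  have e1 := primeCounting_add_eq y h
  have e2 := primeCounting_add_eq (y + s) h
  have e3 := primeCounting_add_eq (y + h) s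
  have e4 := primeCounting_add_eq y s
  have b4 : #{k ∈ range s | (y + (k + 1)).Prime} ≤ s :=
    (card_filter_le _ _).trans (card_range s).le
  rw [show y + s + h = y + h + s by ring] at e2
  omega

/-- **Double counting**: summing over the boxes `k` the number of `u` with `m + W(u) + k + 1`
prime is summing over `u` the number of primes in the window `(m + W(u), m + W(u) + h]`.
[cite: PandeyWoo2024, §2.4] -/
theorem sum_boxes_eq_sum_windows {ι : Type*} (U : Finset ι) (W : ι → ℕ) (m h : ℕ) :
    ∑ k ∈ range h, #{u ∈ U | (m + W u + (k + 1)).Prime} =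
      ∑ u ∈ U, #{k ∈ range h | (m + W u + (k + 1)).Prime} := by
  simp only [card_filter]
  exact sum_comm

/-- The windows `(m + W(u), m + W(u) + h]`, `W(u) ≤ C`, carry in total at most
`#U · (π(m+h) − π(m) + C)` primes … [folklore] -/
theorem sum_windows_le {ι : Type*} (U : Finset ι) {W : ι → ℕ} {C : ℕ} (hW : ∀ u ∈ U, W u ≤ C)
    (m h : ℕ) :
    ∑ u ∈ U, #{k ∈ range h | (m + W u + (k + 1)).Prime} ≤
      #U * (#{k ∈ range h | (m + (k + 1)).Prime} + C) := by
  have h1 : ∑ u ∈ U, #{k ∈ range h | (m + W u + (k + 1)).Prime} ≤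
      ∑ _u ∈ U, (#{k ∈ range h | (m + (k + 1)).Prime} + C) :=
    sum_le_sum fun u hu => by
      have := window_shift_le h (Nat.le_add_right m (W u))
      rw [Nat.add_sub_cancel_left] at this
      have := hW u hu
      omega
  rwa [sum_const, smul_eq_mul] at h1

/-- … and at least `#U · (π(m+h) − π(m) − C)`. [folklore] -/
theorem le_sum_windows {ι : Type*} (U : Finset ι) {W : ι → ℕ} {C : ℕ} (hW : ∀ u ∈ U, W u ≤ C)
    (m h : ℕ) :
    #U * #{k ∈ range h | (m + (k + 1)).Prime} ≤
      ∑ u ∈ U, #{k ∈ range h | (m + W u + (k + 1)).Prime} + #U * C := by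
  have h1 : ∑ _u ∈ U, #{k ∈ range h | (m + (k + 1)).Prime} ≤
      ∑ u ∈ U, (#{k ∈ range h | (m + W u + (k + 1)).Prime} + C) :=
    sum_le_sum fun u hu => by
      have := le_window_shift h (Nat.le_add_right m (W u))
      rw [Nat.add_sub_cancel_left] at this
      have := hW u hu
      omega
  rwa [sum_const, smul_eq_mul, sum_add_distrib, sum_const, smul_eq_mul] at h1

/-- Pigeonhole: some term is at least the average. [folklore] -/
theorem exists_sum_le_mul {h : ℕ} (hh : 1 ≤ h) (f : ℕ → ℕ) :
    ∃ k ∈ range h, ∑ i ∈ range h, f i ≤ h * f k := by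
  have hne : (range h).Nonempty := nonempty_range_iff.2 (by omega)
  refine exists_le_of_sum_le hne (le_of_eq ?_)
  rw [sum_const, card_range, smul_eq_mul, mul_sum]

/-- Pigeonhole: some term is at most the average. [folklore] -/
theorem exists_mul_le_sum {h : ℕ} (hh : 1 ≤ h) (f : ℕ → ℕ) :
    ∃ k ∈ range h, h * f k ≤ ∑ i ∈ range h, f i := by
  have hne : (range h).Nonempty := nonempty_range_iff.2 (by omega)
  refine exists_le_of_sum_le hne (le_of_eq ?_)
  rw [sum_const, card_range, smul_eq_mul, mul_sum]

/-! ## The walk -/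

/-- **The walk along a Bézout direction.** For a linear form `ψ` with non-negative coefficients,
`c₀ = ∑ⱼ cⱼ ≥ 1`, a vector `v` with `ψ(v) = 1`, and integers `m, h, H ≥ 0`: with
`q = ⌊(m+1)/c₀⌋`, `r = (m + 1) mod c₀` and corners `z_k = q𝟙 + (r + k)v`, one has
`ψ(z_k + u) = m + 1 + k + ψ(u)` for `u ∈ {0,…,H}^d`, hence
`∑_{k<h} #{u : ψ(z_k + u) prime} = ∑_u (π(m + ψ(u) + h) − π(m + ψ(u)))`, which lies between
`(H+1)^d (π(m+h) − π(m) ∓ c₀ H)`; and `|z_k,ⱼ − q| ≤ (c₀ + h) ∑ᵢ |vᵢ|`. This theorem records the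
double count and the localisation. [cite: PandeyWoo2024, §2.4] -/
theorem walk_sum_bounds (ψ : AffLinForm d) (h0 : ψ.const = 0) (hc : ∀ j, 0 ≤ ψ.coeff j)
    (hne : ψ.coeff ≠ 0) {v : Fin d → ℤ} (hv : ψ.eval v = 1) (m h Hn : ℕ) :
    let c₀ : ℤ := ∑ j, ψ.coeff j
    let q : ℤ := (m + 1 : ℤ) / c₀
    let r : ℤ := (m + 1 : ℤ) % c₀
    let z : ℕ → Fin d → ℤ := fun k j => q + (r + k) * v j
    let U : Finset (Fin d → ℕ) := Fintype.piFinset fun _ : Fin d => range (Hn + 1)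
    let cnt : ℕ → ℕ := fun k => #{u ∈ U | (ψ.eval (z k + fun j => (u j : ℤ))).toNat.Prime}
    (∀ k j, |z k j - q| ≤ (c₀ + k) * ∑ i, |v i|) ∧
    #U * #{i ∈ range h | (m + (i + 1)).Prime} ≤ ∑ k ∈ range h, cnt k + #U * (c₀.toNat * Hn) ∧
    ∑ k ∈ range h, cnt k ≤ #U * (#{i ∈ range h | (m + (i + 1)).Prime} + c₀.toNat * Hn) := by
  intro c₀ q r z U cnt
  have hc1 : 1 ≤ c₀ := one_le_sum_coeff ψ hc hne
  have hc0 : 0 < c₀ := by omega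
  have hr0 : 0 ≤ r := Int.emod_nonneg _ hc0.ne'
  have hrc : r < c₀ := Int.emod_lt_of_pos _ hc0
  have hqr : c₀ * q + r = m + 1 := by
    have := Int.emod_add_mul_ediv ((m : ℤ) + 1) c₀
    show c₀ * (((m : ℤ) + 1) / c₀) + ((m : ℤ) + 1) % c₀ = m + 1
    linarith
  -- values along the walk
  have hz : ∀ k : ℕ, ψ.eval (z k) = m + 1 + k := by
    intro k
    show ψ.eval (fun j => q + (r + k) * v j) = m + 1 + k
    rw [eval_line ψ h0 hv]
    linarith
  -- `W(u) = ψ(u)` as a natural number, `0 ≤ W(u) ≤ c₀ H`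
  set W : (Fin d → ℕ) → ℕ := fun u => (ψ.eval fun j => (u j : ℤ)).toNat with hWdef
  have hWint : ∀ u : Fin d → ℕ, (W u : ℤ) = ψ.eval fun j => (u j : ℤ) := fun u =>
    Int.toNat_of_nonneg (eval_nonneg ψ h0 hc fun j => by positivity)
  have hWle : ∀ u ∈ U, W u ≤ c₀.toNat * Hn := by
    intro u hu
    have hu' : ∀ j, u j ≤ Hn := fun j => by
      have := Fintype.mem_piFinset.1 hu j
      rw [mem_range] at this
      omega
    have h1 : ψ.eval (fun j => (u j : ℤ)) ≤ c₀ * Hn :=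
      eval_le ψ h0 hc (B := Hn) fun j => by exact_mod_cast hu' j
    have h2 : (W u : ℤ) ≤ (c₀.toNat : ℤ) * Hn := by
      rw [hWint, Int.toNat_of_nonneg hc0.le]; exact h1
    exact_mod_cast h2
  -- the count in box `k` is the count of `u` with `m + W u + (k+1)` prime
  have hcnt : ∀ k, cnt k = #{u ∈ U | (m + W u + (k + 1)).Prime} := by
    intro k
    refine congrArg Finset.card (filter_congr fun u _ => ?_)
    have : (ψ.eval (z k + fun j => (u j : ℤ))).toNat = m + W u + (k + 1) := by
      have h1 : ψ.eval (z k + fun j => (u j : ℤ)) = ((m + W u + (k + 1) : ℕ) : ℤ) := by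
        rw [eval_add ψ h0, hz k]
        push_cast
        rw [hWint]
        ring
      rw [h1, Int.toNat_natCast]
    rw [this]
  refine ⟨fun k j => ?_, ?_, ?_⟩
  · -- localisation
    show |q + (r + k) * v j - q| ≤ (c₀ + k) * ∑ i, |v i|
    rw [add_sub_cancel_left, abs_mul]
    have h1 : |r + (k : ℤ)| ≤ c₀ + k := by rw [abs_of_nonneg (by positivity)]; linarith
    have h2 : |v j| ≤ ∑ i, |v i| := single_le_sum (f := fun i => |v i|) (fun i _ => abs_nonneg _) (mem_univ j)
    exact mul_le_mul h1 h2 (abs_nonneg _) (by positivity)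
  · simp only [hcnt]
    rw [sum_boxes_eq_sum_windows]
    exact le_sum_windows U hWle m h
  · simp only [hcnt]
    rw [sum_boxes_eq_sum_windows]
    exact sum_windows_le U hWle m h

/-- **A box with at least the average.** In the setting of `walk_sum_bounds` with `h ≥ 1`: some
corner `z = z_k`, `k < h` (so within `(c₀ + h)∑|vᵢ|` of `q𝟙`), has
`h · #{u ∈ {0..H}^d : ψ(z + u) prime} ≥ (H+1)^d (π(m+h) − π(m) − c₀ H)`.
[cite: PandeyWoo2024, §2.4 (pigeonhole)] -/
theorem exists_box_ge (ψ : AffLinForm d) (h0 : ψ.const = 0) (hc : ∀ j, 0 ≤ ψ.coeff j)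
    (hne : ψ.coeff ≠ 0) {v : Fin d → ℤ} (hv : ψ.eval v = 1) (m Hn : ℕ) {h : ℕ} (hh : 1 ≤ h) :
    ∃ z : Fin d → ℤ,
      (∀ j, |z j - (m + 1 : ℤ) / (∑ i, ψ.coeff i)| ≤ ((∑ i, ψ.coeff i) + h) * ∑ i, |v i|) ∧
      ((Hn : ℝ) + 1) ^ d * (#{i ∈ range h | (m + (i + 1)).Prime} - (∑ i, ψ.coeff i : ℤ) * Hn) ≤
        h * #{u ∈ Fintype.piFinset (fun _ : Fin d => range (Hn + 1)) |
          (ψ.eval (z + fun j => (u j : ℤ))).toNat.Prime} := by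
  obtain ⟨hloc, hlow, -⟩ := walk_sum_bounds ψ h0 hc hne hv m h Hn
  set c₀ : ℤ := ∑ j, ψ.coeff j with hc₀
  have hc1 : 1 ≤ c₀ := one_le_sum_coeff ψ hc hne
  set U : Finset (Fin d → ℕ) := Fintype.piFinset fun _ : Fin d => range (Hn + 1) with hU
  set q : ℤ := (m + 1 : ℤ) / c₀
  set r : ℤ := (m + 1 : ℤ) % c₀
  obtain ⟨k, hk, hsum⟩ := exists_sum_le_mul hh fun k =>
    #{u ∈ U | (ψ.eval ((fun j => q + (r + k) * v j) + fun j => (u j : ℤ))).toNat.Prime}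
  refine ⟨fun j => q + (r + k) * v j, fun j => ?_, ?_⟩
  · refine (hloc k j).trans (mul_le_mul_of_nonneg_right ?_ (by positivity))
    have := mem_range.1 hk
    have : (k : ℤ) ≤ h := by exact_mod_cast this.le
    linarith
  · have hUcard : (#U : ℝ) = ((Hn : ℝ) + 1) ^ d := by
      rw [hU, Fintype.card_piFinset, prod_const, card_range, card_univ, Fintype.card_fin]
      push_cast
      ring
    have h1 := le_trans hlow (Nat.add_le_add_right hsum _)
    have h2 : ((#U * #{i ∈ range h | (m + (i + 1)).Prime} : ℕ) : ℝ) ≤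
        ((h * #{u ∈ U | (ψ.eval ((fun j => q + (r + k) * v j) + fun j => (u j : ℤ))).toNat.Prime} +
          #U * (c₀.toNat * Hn) : ℕ) : ℝ) := by exact_mod_cast h1
    push_cast at h2
    have hc0' : ((c₀.toNat : ℕ) : ℝ) = ((c₀ : ℤ) : ℝ) := by
      have : (c₀.toNat : ℤ) = c₀ := Int.toNat_of_nonneg (by omega)
      exact_mod_cast this
    rw [hUcard, hc0'] at h2
    nlinarith [h2]

/-- **A box with at most the average.** In the setting of `walk_sum_bounds` with `h ≥ 1`: some
corner `z = z_k`, `k < h`, has `h · #{u ∈ {0..H}^d : ψ(z + u) prime} ≤ (H+1)^d (π(m+h) − π(m) + c₀ H)`.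
[cite: PandeyWoo2024, §2.4 (pigeonhole)] -/
theorem exists_box_le (ψ : AffLinForm d) (h0 : ψ.const = 0) (hc : ∀ j, 0 ≤ ψ.coeff j)
    (hne : ψ.coeff ≠ 0) {v : Fin d → ℤ} (hv : ψ.eval v = 1) (m Hn : ℕ) {h : ℕ} (hh : 1 ≤ h) :
    ∃ z : Fin d → ℤ,
      (∀ j, |z j - (m + 1 : ℤ) / (∑ i, ψ.coeff i)| ≤ ((∑ i, ψ.coeff i) + h) * ∑ i, |v i|) ∧
      (h : ℝ) * #{u ∈ Fintype.piFinset (fun _ : Fin d => range (Hn + 1)) |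
          (ψ.eval (z + fun j => (u j : ℤ))).toNat.Prime} ≤
        ((Hn : ℝ) + 1) ^ d * (#{i ∈ range h | (m + (i + 1)).Prime} + (∑ i, ψ.coeff i : ℤ) * Hn) := by
  obtain ⟨hloc, -, hup⟩ := walk_sum_bounds ψ h0 hc hne hv m h Hn
  set c₀ : ℤ := ∑ j, ψ.coeff j with hc₀
  have hc1 : 1 ≤ c₀ := one_le_sum_coeff ψ hc hne
  set U : Finset (Fin d → ℕ) := Fintype.piFinset fun _ : Fin d => range (Hn + 1) with hU
  set q : ℤ := (m + 1 : ℤ) / c₀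
  set r : ℤ := (m + 1 : ℤ) % c₀
  obtain ⟨k, hk, hsum⟩ := exists_mul_le_sum hh fun k =>
    #{u ∈ U | (ψ.eval ((fun j => q + (r + k) * v j) + fun j => (u j : ℤ))).toNat.Prime}
  refine ⟨fun j => q + (r + k) * v j, fun j => ?_, ?_⟩
  · refine (hloc k j).trans (mul_le_mul_of_nonneg_right ?_ (by positivity))
    have := mem_range.1 hk
    have : (k : ℤ) ≤ h := by exact_mod_cast this.le
    linarith
  · have hUcard : (#U : ℝ) = ((Hn : ℝ) + 1) ^ d := by
      rw [hU, Fintype.card_piFinset, prod_const, card_range, card_univ, Fintype.card_fin]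
      push_cast
      ring
    have h1 := le_trans hsum hup
    have h2 : ((h * #{u ∈ U | (ψ.eval ((fun j => q + (r + k) * v j) + fun j => (u j : ℤ))).toNat.Prime} : ℕ) : ℝ)
        ≤ ((#U * (#{i ∈ range h | (m + (i + 1)).Prime} + c₀.toNat * Hn) : ℕ) : ℝ) := by
      exact_mod_cast h1
    push_cast at h2
    have hc0' : ((c₀.toNat : ℕ) : ℝ) = ((c₀ : ℤ) : ℝ) := by
      have : (c₀.toNat : ℤ) = c₀ := Int.toNat_of_nonneg (by omega)
      exact_mod_cast this
    rw [hUcard, hc0'] at h2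
    nlinarith [h2]

end SingleForm

end Literature.Barriers.Parity
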